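import Summits.QuantumFields.BalabanUV.Beta.GAN24.DressedVertexFaceBondSum
import Summits.QuantumFields.BalabanUV.Beta.GAN24.SandwichReadoutWeighted
import Summits.QuantumFields.BalabanUV.Beta.GAN24.LayerCommutatorAntisymm

/-!
# `BalabanUV.Beta.GAN24.DressedStepFaceChargesWeighted` — binder row G-an2-4 ∕ (CONV-C), conservation law (C) AT LEVELS `j ≥ 1`, CONTACT side, the (γ) hand's
# «DEPTH TOWER» (memo `HOME/b2b-balaban-gan24-formalise-leaf-06/g54/C-LEVELS-GE1-g54.md` §30, letter K6b): **THE TWO-FACE READ-OUT OF `K3OfK` THROUGH THE DRESSED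
# STEP KERNEL WITH FACE-WEIGHTED COARSE LEGS** — leaf-04's (E0) `DressedStepFaceCharges.hasSum_mmRead_K3OfK_dressedStep` with single-coordinate weights `f(x′_α)`,
# `g(z′_β)` on the two coarse legs: the FIELD-leg charges become `∓[a=α]·[y_α exit]·(s_f s_m)·cH_j·f(⌊y_α∕Lc⌋)` (for `f = [· % N = N−1]` the DEEP class
# `[y_α % (Lc·N) = Lc·N − 1]`), and the MULTIPLIER-leg charges VANISH for every such weight — road-P2's `CoarseGaugeSourceResponse.tsum_coord_colM` (a
# multiplier source depending on one coordinate in its own direction is pure gauge: no multiplier response) on the coarse lattice, `MultiplierZeroMass` off it —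
# so the weighted read-out has EXACTLY leaf-04's shape (`hasSum_mmRead_K3OfK_dressedStep_weight`).

NOT IN PRINT; OUR BOOKKEEPING ([folklore] BY NAME over this lineage's K1a `DressedVertexFaceBondSum.hasSum_dressedStep_col_coordWeight` (the weighted column charge),
K6a `SandwichReadoutWeighted.hasSum_mmRead_K3OfK_weight` (the weighted read-out with hypothesised charges), leaf-02's `LayerCommutatorAntisymm.trK_unitK_coDress`
(`X̃ᵀ = sgnK X̃`: rows from columns), road-P2's `CoarseGaugeSourceResponse.tsum_coord_colM ∕ summable_source_colM ∕ summable_bdd_mul`,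
`MultiplierZeroMass.KInvStep_inr_inr_off_right`, an2's `AxialDressingRooted.coDressKBmAt_inr_inr`; G-an2-4 formalisation swarm, leaf prover `b2b-balaban-gan24-formalise-leaf-06`, gen 54).
HONEST FRAMING (cell contract, verbatim): «discharging `BetaPertH` makes Bałaban's UV stability UNCONDITIONAL — a real constructive-QFT result; it is NOT the continuum limit
and NOT the Clay problem.»  HONEST DEPENDENCY (verbatim): «continuum YM on T⁴ ⇐ BetaPertH ∧ nine spine estimates (0/9 proved); BetaPertH ⇐ (D1) ∧ (D4) ∧ CAP+tail; G-an2-4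
gates asym, D1 and NE2/3/4.»

WHY (memo §30): the FOUR-FACE functional of road-P2's one-step charge law (`T2RecChargeStepFourFace.zmode_succ_eq_fourFace`; leaf-02 Part 39) restricts the member's legs —
the lower level's multiplier legs at the dilated points — to exit faces of period `Lc`; this is (E0) with the weights `f = g = [· % Lc = Lc − 1]`.  In the zero mode
(leaf-04's 21 `DressedSourceZeroModeWords`, unweighted) the multiplier-leg charges vanish by zero mass (`MultiplierZeroMass.hasSum_KInvStep_mm_left`); with face
weights IN THE LEG's OWN DIRECTION they STILL vanish (slab-wise: `tsum_coord_colM`), so the four-face reading of the member's source part is leaf-04's three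
two-face words with DEEP leg classes and nothing else (memo §29 (1), §32).

WHAT ([folklore]; in-block root `toSite r`, `1 ≤ Lc`, every `j`, all units `s_f s_m`, bounded single-coordinate weights; 0 `def`, 0 cited facts, 0 `def … : Prop`, 0 sorry):
§1 `dressedStep_inr_row_eq` (rows from columns), `hasSum_dressedStep_row_coordWeight_inl` ∕ `hasSum_dressedStep_col_coordWeight_inl` (field legs: the weighted
exit-face charges), `hasSum_dressedStep_row_weight_inr` ∕ `hasSum_dressedStep_col_weight_inr` (multiplier legs: the weighted sums are ZERO),
`hasSum_dressedStep_row_weight` ∕ `hasSum_dressedStep_col_weight` (both fibres, `Sum.elim`); §2 **`hasSum_mmRead_K3OfK_dressedStep_weight`**.  Asserts NO value of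
Bałaban's tables; discharges NOTHING of (C) ∕ (C)sym ∕ (Q-D); NEVER «G-an2-4 closed» as (CONV-C); NOT D1, NOT `BetaPertH`, NOT continuum, NOT Clay.  2026-08-24; no existing
file touched.
-/

noncomputable section

open Finset
open scoped BigOperators
open Literature.MathematicalPhysics.QuantumFieldTheory
open Literature.MathematicalPhysics.QuantumFieldTheory.Balaban1983to89
open Literature.MathematicalPhysics.QuantumFieldTheory.Balaban1983to89.Beta
open B12Sec2to5 (l1 l1_nonneg)
open ExpKernelCalculus (Site MKer Decays comp)
open OneStepResolventKernel (Fib)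
open SecondOrderResponse (dM)
open BalabanStepW2 (K3OfK)
open BalabanStepJetsSucc (mmRead)
open OneStepKernelFamily (KInvStep decays_KInvStep)
open AffineAveraging (box toSite)
open AveragingContours (blk)
open AxialProjector (blk_zsmul)
open Summit.QuantumFields.BalabanUV.Beta.TameKernelCalculus (Loc trK trK_apply)
open Summit.QuantumFields.BalabanUV.Beta.BorderedHessian (stepScale sgnF sgnF_inl sgnF_inr sgnK sgnK_apply)
open Literature.Probability.LatticeModels (Torus.proj)
open LatticeForm (quo)
open OneStepResolventKernel (eq_zsmul_quo_of_proj)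
open SecondOrderResponse (colM)
open Summit.QuantumFields.BalabanUV.Beta.AxialDressingRooted (coDressKBmAt decays_coDressKBmAt coDressKBmAt_inr_inr)
open Summit.QuantumFields.BalabanUV.Beta.GAN24.CoarseGaugeSourceResponse (summable_bdd_mul summable_source_colM tsum_coord_colM)
open Summit.QuantumFields.BalabanUV.Beta.GAN24.MultiplierZeroMass (KInvStep_inr_inr_off_right)
open Summit.QuantumFields.BalabanUV.Beta.HessKerDressedUnits (unitK unitK_apply legScale_inr decays_unitK)
open Summit.QuantumFields.BalabanUV.Beta.GAN24.LayerCommutatorAntisymm (trK_unitK_coDress)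
open Summit.QuantumFields.BalabanUV.Beta.GAN24.DressedVertexFaceBondSum (hasSum_dressedStep_col_coordWeight)
open Summit.QuantumFields.BalabanUV.Beta.GAN24.SandwichReadoutWeighted (hasSum_mmRead_K3OfK_weight)

namespace Summit.QuantumFields.BalabanUV.Beta.GAN24.DressedStepFaceChargesWeighted

variable {d : ℕ} {Lc : ℕ} [NeZero Lc] {r : Fin (d + 1) → ℕ}

/-! ## §1 The weighted coarse-leg charges of the dressed step kernel -/

/-- [folklore] **ROWS FROM COLUMNS** (`X̃ᵀ = sgnK X̃`): `X̃ x y (inr α) b = sgnF b · (−1) · X̃ y x b (inr α)`. -/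
theorem dressedStep_inr_row_eq (hr : r ∈ box (d + 1) Lc) (sf sm : ℝ) (j : ℕ) (x y : Site (d + 1)) (α : Fin (d + 1)) (b : Fib d) :
    unitK sf sm (coDressKBmAt (toSite r) Lc (KInvStep (d := d) Lc j)) x y (Sum.inr α) b =
      -(sgnF b * unitK sf sm (coDressKBmAt (toSite r) Lc (KInvStep (d := d) Lc j)) y x b (Sum.inr α)) := by
  have h := congrFun (congrFun (congrFun (congrFun (trK_unitK_coDress (d := d) hr j sf sm) y) x) b) (Sum.inr α)
  rw [trK_apply, sgnK_apply, sgnF_inr] at h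
  rw [h]
  ring

/-- [folklore] **THE WEIGHTED ROW CHARGE ON A FIELD LEG**: `Σ_{x′} f(x′_α)·X̃(Lc•x′, y)_{(inr α, inl a)} = −[a = α ∧ y_α % Lc = Lc−1]·(s_f s_m)·cH_j·f(⌊y_α∕Lc⌋)`
(K1a's weighted column charge, transposed). -/
theorem hasSum_dressedStep_row_coordWeight_inl (hr : r ∈ box (d + 1) Lc) (sf sm : ℝ) (j : ℕ) (α : Fin (d + 1)) (f : ℤ → ℝ) {B : ℝ} (hf : ∀ s, |f s| ≤ B)
    (a : Fin (d + 1)) (y : Site (d + 1)) :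
    HasSum (fun x' : Site (d + 1) => f (x' α) * unitK sf sm (coDressKBmAt (toSite r) Lc (KInvStep (d := d) Lc j)) ((Lc : ℤ) • x') y (Sum.inr α) (Sum.inl a))
      (if a = α ∧ y α % (Lc : ℤ) = (Lc : ℤ) - 1 then -((sf * sm) * ((stepScale d Lc j * (Lc : ℝ) ^ (d + 1))⁻¹ * f (blk Lc y α))) else 0) := by
  have hLc : 1 ≤ Lc := Nat.one_le_iff_ne_zero.2 (NeZero.ne Lc)
  have h := hasSum_dressedStep_col_coordWeight (d := d) hr sf sm j α f hf (Sum.inl a) y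
  simp only [Sum.elim_inl, blk_zsmul hLc] at h
  have hv : (if a = α ∧ y α % (Lc : ℤ) = (Lc : ℤ) - 1 then -((sf * sm) * ((stepScale d Lc j * (Lc : ℝ) ^ (d + 1))⁻¹ * f (blk Lc y α))) else 0) =
      -(if a = α ∧ y α % (Lc : ℤ) = (Lc : ℤ) - 1 then (sf * sm) * ((stepScale d Lc j * (Lc : ℝ) ^ (d + 1))⁻¹ * f (blk Lc y α)) else 0) := by
    split_ifs <;> simp
  rw [hv]
  refine h.neg.congr_fun fun x' => ?_
  show f (x' α) * unitK sf sm (coDressKBmAt (toSite r) Lc (KInvStep (d := d) Lc j)) ((Lc : ℤ) • x') y (Sum.inr α) (Sum.inl a) = -(f (x' α) * unitK sf sm (coDressKBmAt (toSite r) Lc (KInvStep (d := d) Lc j)) y ((Lc : ℤ) • x') (Sum.inl a) (Sum.inr α))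
  rw [dressedStep_inr_row_eq hr sf sm j, sgnF_inl]
  ring

/-- [folklore] **THE WEIGHTED COLUMN CHARGE ON A FIELD LEG** (K1a, field fibre): `Σ_{z′} g(z′_β)·X̃(w, Lc•z′)_{(inl b, inr β)} = [b = β ∧ w_β % Lc = Lc−1]·(s_f s_m)·cH_j·g(⌊w_β∕Lc⌋)`. -/
theorem hasSum_dressedStep_col_coordWeight_inl (hr : r ∈ box (d + 1) Lc) (sf sm : ℝ) (j : ℕ) (β : Fin (d + 1)) (g : ℤ → ℝ) {B : ℝ} (hg : ∀ s, |g s| ≤ B)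
    (b : Fin (d + 1)) (w : Site (d + 1)) :
    HasSum (fun z' : Site (d + 1) => g (z' β) * unitK sf sm (coDressKBmAt (toSite r) Lc (KInvStep (d := d) Lc j)) w ((Lc : ℤ) • z') (Sum.inl b) (Sum.inr β))
      (if b = β ∧ w β % (Lc : ℤ) = (Lc : ℤ) - 1 then (sf * sm) * ((stepScale d Lc j * (Lc : ℝ) ^ (d + 1))⁻¹ * g (blk Lc w β)) else 0) := by
  have hLc : 1 ≤ Lc := Nat.one_le_iff_ne_zero.2 (NeZero.ne Lc)
  have h := hasSum_dressedStep_col_coordWeight (d := d) hr sf sm j β g hg (Sum.inl b) w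
  simp only [Sum.elim_inl, blk_zsmul hLc] at h
  exact h

/-- [folklore] **THE WEIGHTED ROW SUM ON A MULTIPLIER LEG VANISHES** (every bounded single-coordinate weight in the leg's own direction): on the coarse lattice
(`y = Lc•quo y`) it is `s_m²·Σ'_{x′} f(x′_α)·colM G_j Lc α x′ m (quo y) = 0` by road-P2's `tsum_coord_colM` (a one-coordinate multiplier source is pure gauge); off it the
multiplier block is zero (`KInvStep_inr_inr_off_right`). -/
theorem hasSum_dressedStep_row_weight_inr (hr : r ∈ box (d + 1) Lc) (sf sm : ℝ) (j : ℕ) (α : Fin (d + 1)) (f : ℤ → ℝ) {B : ℝ} (hf : ∀ s, |f s| ≤ B)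
    (m : Fin (d + 1)) (y : Site (d + 1)) :
    HasSum (fun x' : Site (d + 1) => f (x' α) * unitK sf sm (coDressKBmAt (toSite r) Lc (KInvStep (d := d) Lc j)) ((Lc : ℤ) • x') y (Sum.inr α) (Sum.inr m)) 0 := by
  classical
  by_cases hy : Torus.proj Lc y = 0
  · have e : ∀ x' : Site (d + 1), f (x' α) * unitK sf sm (coDressKBmAt (toSite r) Lc (KInvStep (d := d) Lc j)) ((Lc : ℤ) • x') y (Sum.inr α) (Sum.inr m) =
        (sm * sm) * (f (x' α) * colM (coDressKBmAt (toSite r) Lc (KInvStep (d := d) Lc j)) Lc α x' m (quo Lc y)) := by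
      intro x'
      rw [dressedStep_inr_row_eq hr sf sm j, sgnF_inr, unitK_apply, legScale_inr, legScale_inr]
      conv_lhs => rw [eq_zsmul_quo_of_proj (N := Lc) hy]
      simp only [colM]
      ring
    simp_rw [e]
    have hs := summable_bdd_mul (summable_source_colM (d := d) (Lc := Lc) (toSite r) j α m (quo Lc y)) (fun x' : Site (d + 1) => hf (x' α))
    have h := hs.hasSum
    rw [tsum_coord_colM (d := d) (Lc := Lc) (toSite r) j α f hf m (quo Lc y)] at h
    simpa using h.mul_left (sm * sm)
  · have e : ∀ x' : Site (d + 1), f (x' α) * unitK sf sm (coDressKBmAt (toSite r) Lc (KInvStep (d := d) Lc j)) ((Lc : ℤ) • x') y (Sum.inr α) (Sum.inr m) = 0 := by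
      intro x'
      rw [unitK_apply, coDressKBmAt_inr_inr, KInvStep_inr_inr_off_right j hy]
      ring
    simp_rw [e]
    exact hasSum_zero

/-- [folklore] **THE WEIGHTED COLUMN SUM ON A MULTIPLIER LEG VANISHES** (same mechanism). -/
theorem hasSum_dressedStep_col_weight_inr (hr : r ∈ box (d + 1) Lc) (sf sm : ℝ) (j : ℕ) (β : Fin (d + 1)) (g : ℤ → ℝ) {B : ℝ} (hg : ∀ s, |g s| ≤ B)
    (m : Fin (d + 1)) (w : Site (d + 1)) :
    HasSum (fun z' : Site (d + 1) => g (z' β) * unitK sf sm (coDressKBmAt (toSite r) Lc (KInvStep (d := d) Lc j)) w ((Lc : ℤ) • z') (Sum.inr m) (Sum.inr β)) 0 := by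
  classical
  by_cases hw : Torus.proj Lc w = 0
  · have e : ∀ z' : Site (d + 1), g (z' β) * unitK sf sm (coDressKBmAt (toSite r) Lc (KInvStep (d := d) Lc j)) w ((Lc : ℤ) • z') (Sum.inr m) (Sum.inr β) =
        (sm * sm) * (g (z' β) * colM (coDressKBmAt (toSite r) Lc (KInvStep (d := d) Lc j)) Lc β z' m (quo Lc w)) := by
      intro z'
      rw [unitK_apply, legScale_inr, legScale_inr]
      conv_lhs => rw [eq_zsmul_quo_of_proj (N := Lc) hw]
      simp only [colM]
      ring
    simp_rw [e]
    have hs := summable_bdd_mul (summable_source_colM (d := d) (Lc := Lc) (toSite r) j β m (quo Lc w)) (fun z' : Site (d + 1) => hg (z' β))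
    have h := hs.hasSum
    rw [tsum_coord_colM (d := d) (Lc := Lc) (toSite r) j β g hg m (quo Lc w)] at h
    simpa using h.mul_left (sm * sm)
  · have e : ∀ z' : Site (d + 1), g (z' β) * unitK sf sm (coDressKBmAt (toSite r) Lc (KInvStep (d := d) Lc j)) w ((Lc : ℤ) • z') (Sum.inr m) (Sum.inr β) = 0 := by
      intro z'
      rw [dressedStep_inr_row_eq hr sf sm j, sgnF_inr, unitK_apply, coDressKBmAt_inr_inr, KInvStep_inr_inr_off_right j hw]
      ring
    simp_rw [e]
    exact hasSum_zero

/-- [folklore] **THE WEIGHTED ROW CHARGES OF THE DRESSED STEP KERNEL, ON THE FIBRE**: field legs `inl a ↦ −[a=α]·[y_α exit]·(s_f s_m)cH_j·f(⌊y_α∕Lc⌋)`, multiplier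
legs `inr m ↦ 0`. -/
theorem hasSum_dressedStep_row_weight (hr : r ∈ box (d + 1) Lc) (sf sm : ℝ) (j : ℕ) (α : Fin (d + 1)) (f : ℤ → ℝ) {B : ℝ} (hf : ∀ s, |f s| ≤ B)
    (b : Fib d) (y : Site (d + 1)) :
    HasSum (fun x' : Site (d + 1) => f (x' α) * unitK sf sm (coDressKBmAt (toSite r) Lc (KInvStep (d := d) Lc j)) ((Lc : ℤ) • x') y (Sum.inr α) b)
      (Sum.elim (fun a => if a = α ∧ y α % (Lc : ℤ) = (Lc : ℤ) - 1 then -((sf * sm) * ((stepScale d Lc j * (Lc : ℝ) ^ (d + 1))⁻¹ * f (blk Lc y α))) else 0)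
        (fun _ => (0 : ℝ)) b) := by
  rcases b with a | m
  · exact hasSum_dressedStep_row_coordWeight_inl hr sf sm j α f hf a y
  · exact hasSum_dressedStep_row_weight_inr hr sf sm j α f hf m y

/-- [folklore] **THE WEIGHTED COLUMN CHARGES OF THE DRESSED STEP KERNEL, ON THE FIBRE**: field legs `inl b ↦ +[b=β]·[w_β exit]·(s_f s_m)cH_j·g(⌊w_β∕Lc⌋)`, multiplier
legs `inr m ↦ 0`. -/
theorem hasSum_dressedStep_col_weight (hr : r ∈ box (d + 1) Lc) (sf sm : ℝ) (j : ℕ) (β : Fin (d + 1)) (g : ℤ → ℝ) {B : ℝ} (hg : ∀ s, |g s| ≤ B)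
    (b : Fib d) (w : Site (d + 1)) :
    HasSum (fun z' : Site (d + 1) => g (z' β) * unitK sf sm (coDressKBmAt (toSite r) Lc (KInvStep (d := d) Lc j)) w ((Lc : ℤ) • z') b (Sum.inr β))
      (Sum.elim (fun b' => if b' = β ∧ w β % (Lc : ℤ) = (Lc : ℤ) - 1 then (sf * sm) * ((stepScale d Lc j * (Lc : ℝ) ^ (d + 1))⁻¹ * g (blk Lc w β)) else 0)
        (fun _ => (0 : ℝ)) b) := by
  rcases b with b' | m
  · exact hasSum_dressedStep_col_coordWeight_inl hr sf sm j β g hg b' w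
  · exact hasSum_dressedStep_col_weight_inr hr sf sm j β g hg m w

/-! ## §2 The weighted two-face read-out of `K3OfK` through the dressed step kernel -/

/-- [folklore] **THE TWO-FACE READ-OUT OF an2's `K3OfK` THROUGH THE DRESSED STEP KERNEL, FACE-WEIGHTED COARSE LEGS** (in-block root, `1 ≤ Lc`, every level `j`, all
units, bounded single-coordinate weights `f(x′_α)`, `g(z′_β)`): with the weighted charges `ρL^f`, `ρR^g` of §1 and `R[V] := Σ'_{(y,w)} Σ_{φ,γ} ρL^f φ y·V y w φ γ·ρR^g γ w`,
`Σ'_{(x′,z′)} f(x′_α)·g(z′_β)·(mmRead Lc (K3OfK X̃♮_j Lc S M W μ y ν y′))(x′,z′)_{αβ} = R[(dM_μ∘X̃♮_j)∘dM_ν] + R[(dM_ν∘X̃♮_j)∘dM_μ] − R[W_{μν}]` — leaf-04's (E0) is the case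
`f = g = 1`; the multiplier-leg charges are `0` for EVERY such weight. -/
theorem hasSum_mmRead_K3OfK_dressedStep_weight (hLc : 1 ≤ Lc) (hr : r ∈ box (d + 1) Lc) (sf sm : ℝ) (j : ℕ)
    {S M : Fin (d + 1) → Site (d + 1) → MKer (d + 1) (Fib d)}
    {W : Fin (d + 1) → Site (d + 1) → Fin (d + 1) → Site (d + 1) → MKer (d + 1) (Fib d)} {μ ν : Fin (d + 1)} {y y' : Site (d + 1)}
    (hb : Loc (dM (unitK sf sm (coDressKBmAt (toSite r) Lc (KInvStep (d := d) Lc j))) Lc S M μ y)) (hb' : Loc (dM (unitK sf sm (coDressKBmAt (toSite r) Lc (KInvStep (d := d) Lc j))) Lc S M ν y')) (hW : Loc (W μ y ν y')) (α β : Fin (d + 1))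
    (f g : ℤ → ℝ) {Bf Bg : ℝ} (hf : ∀ s, |f s| ≤ Bf) (hg : ∀ s, |g s| ≤ Bg) :
    HasSum (fun xz : Site (d + 1) × Site (d + 1) =>
        f (xz.1 α) * g (xz.2 β) * mmRead Lc (K3OfK (unitK sf sm (coDressKBmAt (toSite r) Lc (KInvStep (d := d) Lc j))) Lc S M W μ y ν y') xz.1 xz.2 (Sum.inl α) (Sum.inl β))
      ((∑' yw : Site (d + 1) × Site (d + 1), ∑ φ' : Fib d, ∑ γ' : Fib d,
          Sum.elim (fun a => if a = α ∧ yw.1 α % (Lc : ℤ) = (Lc : ℤ) - 1 then -((sf * sm) * ((stepScale d Lc j * (Lc : ℝ) ^ (d + 1))⁻¹ * f (blk Lc yw.1 α))) else 0)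
              (fun _ => (0 : ℝ)) φ' *
            comp (comp (dM (unitK sf sm (coDressKBmAt (toSite r) Lc (KInvStep (d := d) Lc j))) Lc S M μ y) (unitK sf sm (coDressKBmAt (toSite r) Lc (KInvStep (d := d) Lc j)))) (dM (unitK sf sm (coDressKBmAt (toSite r) Lc (KInvStep (d := d) Lc j))) Lc S M ν y') yw.1 yw.2 φ' γ' *
          Sum.elim (fun b' => if b' = β ∧ yw.2 β % (Lc : ℤ) = (Lc : ℤ) - 1 then (sf * sm) * ((stepScale d Lc j * (Lc : ℝ) ^ (d + 1))⁻¹ * g (blk Lc yw.2 β)) else 0)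
              (fun _ => (0 : ℝ)) γ') +
        (∑' yw : Site (d + 1) × Site (d + 1), ∑ φ' : Fib d, ∑ γ' : Fib d,
          Sum.elim (fun a => if a = α ∧ yw.1 α % (Lc : ℤ) = (Lc : ℤ) - 1 then -((sf * sm) * ((stepScale d Lc j * (Lc : ℝ) ^ (d + 1))⁻¹ * f (blk Lc yw.1 α))) else 0)
              (fun _ => (0 : ℝ)) φ' *
            comp (comp (dM (unitK sf sm (coDressKBmAt (toSite r) Lc (KInvStep (d := d) Lc j))) Lc S M ν y') (unitK sf sm (coDressKBmAt (toSite r) Lc (KInvStep (d := d) Lc j)))) (dM (unitK sf sm (coDressKBmAt (toSite r) Lc (KInvStep (d := d) Lc j))) Lc S M μ y) yw.1 yw.2 φ' γ' *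
          Sum.elim (fun b' => if b' = β ∧ yw.2 β % (Lc : ℤ) = (Lc : ℤ) - 1 then (sf * sm) * ((stepScale d Lc j * (Lc : ℝ) ^ (d + 1))⁻¹ * g (blk Lc yw.2 β)) else 0)
              (fun _ => (0 : ℝ)) γ') -
        ∑' yw : Site (d + 1) × Site (d + 1), ∑ φ' : Fib d, ∑ γ' : Fib d,
          Sum.elim (fun a => if a = α ∧ yw.1 α % (Lc : ℤ) = (Lc : ℤ) - 1 then -((sf * sm) * ((stepScale d Lc j * (Lc : ℝ) ^ (d + 1))⁻¹ * f (blk Lc yw.1 α))) else 0)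
              (fun _ => (0 : ℝ)) φ' *
            W μ y ν y' yw.1 yw.2 φ' γ' *
          Sum.elim (fun b' => if b' = β ∧ yw.2 β % (Lc : ℤ) = (Lc : ℤ) - 1 then (sf * sm) * ((stepScale d Lc j * (Lc : ℝ) ^ (d + 1))⁻¹ * g (blk Lc yw.2 β)) else 0)
              (fun _ => (0 : ℝ)) γ') := by
  obtain ⟨δ, C', hδ, -, hK'⟩ := decays_coDressKBmAt hLc hr (decays_KInvStep (d := d) (Lc := Lc) j)
  have hKu : Decays (unitK sf sm (coDressKBmAt (toSite r) Lc (KInvStep (d := d) Lc j))) (max |sf| |sm| * C' * max |sf| |sm|) δ := decays_unitK hK'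
  exact hasSum_mmRead_K3OfK_weight (N := Lc) hKu hδ hb hb' hW α β (φ := fun x' => f (x' α)) (ψ := fun z' => g (z' β))
    (fun x' => hf (x' α)) (fun z' => hg (z' β))
    (ρL := fun b yy => Sum.elim (fun a => if a = α ∧ yy α % (Lc : ℤ) = (Lc : ℤ) - 1 then -((sf * sm) * ((stepScale d Lc j * (Lc : ℝ) ^ (d + 1))⁻¹ * f (blk Lc yy α))) else 0)
        (fun _ => (0 : ℝ)) b)
    (ρR := fun b ww => Sum.elim (fun b' => if b' = β ∧ ww β % (Lc : ℤ) = (Lc : ℤ) - 1 then (sf * sm) * ((stepScale d Lc j * (Lc : ℝ) ^ (d + 1))⁻¹ * g (blk Lc ww β)) else 0)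
        (fun _ => (0 : ℝ)) b)
    (fun b w => hasSum_dressedStep_row_weight hr sf sm j α f hf b w) (fun b w => hasSum_dressedStep_col_weight hr sf sm j β g hg b w)

end Summit.QuantumFields.BalabanUV.Beta.GAN24.DressedStepFaceChargesWeighted

end
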